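import Mathlib.Analysis.Complex.Basic
import Mathlib.LinearAlgebra.Matrix.Trace
import Mathlib.LinearAlgebra.Matrix.ConjTranspose
import Mathlib.Data.Fintype.BigOperators
import Mathlib.Tactic.DeriveFintype
import HarnessLib

/-!
# Pauli expansion on a qubit register — definitions

The vocabulary of the Pauli-basis technique of Kempe–Regev–Unger–de Wolf, *Upper bounds on the
noise threshold for fault-tolerant quantum computing*, Quantum Inf. Comput. 10 (2010) 361–376,
§2 (Preliminaries) [KempeEtAl2010], over registers `ι → Bool` for a finite wire set `ι` (the
tree's `QReg n` of `QubitRegister.lean` is `ι = Fin n`):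

* the Pauli alphabet `Pauli = {I, X, Y, Z}` and the one-qubit matrices
  `Pauli.mat Q : Matrix Bool Bool ℂ` (`false = |0⟩`, `true = |1⟩`; `I = 1`, `X = [[0,1],[1,0]]`,
  `Y = [[0,-i],[i,0]]`, `Z = diag(1,-1)`), with the finite tables of §2: `σ² = 1`, Hermitian,
  `Tr(σ_Q σ_Q') = 2[Q = Q']` (orthogonality), `Σ_Q (σ_Q)_{ab}(σ_Q)_{cd} = 2[a=d][b=c]`
  (completeness), the conjugation table `σ_Q σ_P σ_Q = ±σ_P` with `Σ_Q ± = 4[P = I]`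
  (Observation 4: the uniform Pauli twirl kills every non-identity Pauli) and the one-qubit
  expansion `M = ½ Σ_Q Tr(σ_Q M) σ_Q`;
* `tensorAll A` — the tensor product `⊗ᵢ Aᵢ` of one-qubit matrices, as the matrix with entries
  `∏ᵢ Aᵢ (xᵢ) (yᵢ)` on the register; Pauli strings `pauliString S = ⊗ᵢ σ_{Sᵢ}` (`𝒫ⁿ` of §2)
  and Pauli coefficients `pauliCoeff M S = Tr(S · M)` (`δ̂(S)` of §2);
* `stringsOn W` (strings that are the identity outside `W : Finset ι`, i.e. `𝒫^W ⊗ I`) and the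
  **Pauli weight** `pauliWeight M W = Σ_{S ∈ stringsOn W} |Tr(S M)|²` — the quantity
  `Σ_{S ∈ 𝒫^V} δ̂_V(S)²` of Lemma 7, by Observation 3 (`δ̂(S I^{W∖V}) = δ̂_V(S)`);
* `reduceTo W M` — the partial trace over the wires outside `W`, embedded back into the
  register (supported on the labels vanishing outside `W`): the reduced operator `δ_V` of §3.

The theory (Parseval, orthogonality of strings, behaviour under noise, one-qubit channels,
unitaries and partial trace) is developed in the sibling files `PauliParseval.lean` etc.; this
file only fixes definitions and the `2 × 2` tables.

## References

* [KempeEtAl2010] J. Kempe, O. Regev, F. Unger, R. de Wolf, Quantum Inf. Comput. 10 (2010)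
  361–376; arXiv:0802.1464, §2 (Preliminaries), Observations 3–4, §3 (δ_V).

## Mathlib / tree search

Mathlib has no Pauli matrices, Pauli strings, Pauli/Hilbert–Schmidt Parseval or partial trace
(`lean search 'pauli|Kraus|partialTrace'`; `Matrix.kroneckerMap` is binary and would need a
reindexing per wire). The tree has `Fin 2`-indexed Pauli matrices
(`Literature.MathematicalPhysics.QuantumLattice.spinHalfPauli`, `…FunctionSpaces.pauliMatrix`)
and `QReg 1`-indexed `pauliX`, `pauliZ` (`QubitRegister.lean`), `pauliY` (the barrier file);
registers are `Fin n → Bool`, so tensor factors are `Bool`-indexed here (entry formula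
`∏ᵢ Aᵢ (xᵢ) (yᵢ)` with no reindexing); the bridge `placeGate (wire j) pauliX = tensorAll …` is
proved where it is used.
-/

noncomputable section

open Matrix Finset

namespace Literature.Computability.QuantumComplexity

/-! ### The one-qubit Pauli matrices -/

/-- The Pauli alphabet `{I, X, Y, Z}`. [cite: KempeEtAl2010, §2 (𝒫 = {I,X,Y,Z})] -/
inductive Pauli
  | I
  | X
  | Y
  | Z
  deriving DecidableEq, Fintype, Inhabited

namespace Pauli

/-- The one-qubit Pauli matrices on the index type `Bool` (`false = |0⟩`, `true = |1⟩`):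
`I = 1`, `X = [[0,1],[1,0]]`, `Y = [[0,-i],[i,0]]`, `Z = diag(1,-1)`. [cite: KempeEtAl2010, §2] -/
def mat : Pauli → Matrix Bool Bool ℂ
  | I => 1
  | X => Matrix.of fun a b => if a = b then 0 else 1
  | Y => Matrix.of fun a b => if a = b then 0 else if a then Complex.I else -Complex.I
  | Z => Matrix.of fun a b => if a = b then (if a then -1 else 1) else 0

/-- The universe of the Pauli alphabet. [folklore] -/
theorem univ_eq : (Finset.univ : Finset Pauli) = {I, X, Y, Z} := by
  ext Q; cases Q <;> simp

/-- Sums over the Pauli alphabet, unfolded. [folklore] -/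
theorem sum_univ {M : Type*} [AddCommMonoid M] (f : Pauli → M) :
    ∑ Q, f Q = f I + f X + f Y + f Z := by
  rw [univ_eq, Finset.sum_insert (by decide), Finset.sum_insert (by decide),
    Finset.sum_insert (by decide), Finset.sum_singleton, add_assoc, add_assoc]

/-- The alphabet has four letters. [folklore] -/
theorem card_univ : Fintype.card Pauli = 4 := by
  rw [Fintype.card, univ_eq]; rfl

/-- Entries of `I`. [folklore] -/
@[simp] theorem mat_I_apply (a b : Bool) : mat I a b = if a = b then 1 else 0 := by
  simp [mat, Matrix.one_apply]

/-- Entries of `X`. [folklore] -/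
@[simp] theorem mat_X_apply (a b : Bool) : mat X a b = if a = b then 0 else 1 := rfl

/-- Entries of `Y`. [folklore] -/
@[simp] theorem mat_Y_apply (a b : Bool) :
    mat Y a b = if a = b then 0 else if a then Complex.I else -Complex.I := rfl

/-- Entries of `Z`. [folklore] -/
@[simp] theorem mat_Z_apply (a b : Bool) :
    mat Z a b = if a = b then (if a then -1 else 1) else 0 := rfl

/-- Products of two one-qubit matrices, entrywise over `Bool`. [folklore] -/
theorem mul_apply_bool (A B : Matrix Bool Bool ℂ) (a b : Bool) :
    (A * B) a b = A a true * B true b + A a false * B false b := by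
  rw [Matrix.mul_apply, Fintype.sum_bool]

/-- The Pauli matrices are Hermitian: `σ_Qᴴ = σ_Q`. [cite: KempeEtAl2010, §2] -/
theorem conjTranspose_mat (Q : Pauli) : (mat Q)ᴴ = mat Q := by
  ext a b
  cases Q <;> cases a <;> cases b <;> simp [Matrix.conjTranspose_apply]

/-- The Pauli matrices are involutions: `σ_Q σ_Q = 1`. [cite: KempeEtAl2010, §2] -/
theorem mat_mul_self (Q : Pauli) : mat Q * mat Q = 1 := by
  ext a b
  cases Q <;> cases a <;> cases b <;> simp [mul_apply_bool]

/-- Trace orthogonality of the Pauli matrices: `Tr(σ_Q σ_Q') = 2 [Q = Q']`.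
[cite: KempeEtAl2010, §2 (Tr(SS') = 2^n if S = S' and 0 otherwise)] -/
theorem trace_mat_mul_mat (Q Q' : Pauli) :
    (mat Q * mat Q').trace = if Q = Q' then 2 else 0 := by
  rw [Matrix.trace, Fintype.sum_bool, Matrix.diag_apply, Matrix.diag_apply, mul_apply_bool,
    mul_apply_bool]
  cases Q <;> cases Q' <;> simp <;> ring

/-- Completeness of the Pauli basis of `2 × 2` matrices:
`Σ_Q (σ_Q)_{ab} (σ_Q)_{cd} = 2 [a = d] [b = c]`. [cite: KempeEtAl2010, §2 (𝒫ⁿ is an orthogonal basis)] -/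
theorem sum_mat_mul_mat (a b c d : Bool) :
    ∑ Q, mat Q a b * mat Q c d = if a = d ∧ b = c then 2 else 0 := by
  rw [sum_univ]
  cases a <;> cases b <;> cases c <;> cases d <;> simp <;> ring

/-- The sign in the conjugation table `σ_Q σ_P σ_Q = sign(Q,P) σ_P`: `+1` if `Q = I`, `P = I` or
`Q = P` (commuting pair), `-1` otherwise (anticommuting pair). [cite: KempeEtAl2010, §2 and Observation 4] -/
def sign (Q P : Pauli) : ℂ :=
  if Q = I ∨ P = I ∨ Q = P then 1 else -1

/-- Conjugation table of the Pauli matrices: `σ_Q σ_P σ_Q = ± σ_P`.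
[cite: KempeEtAl2010, Observation 4 (proof)] -/
theorem mat_mul_mat_mul_mat (Q P : Pauli) : mat Q * mat P * mat Q = sign Q P • mat P := by
  ext a b
  simp only [Matrix.smul_apply, smul_eq_mul, mul_apply_bool, sign]
  cases Q <;> cases P <;> cases a <;> cases b <;> simp

/-- Averaging the conjugation signs over `Q`: `Σ_Q sign(Q,P) = 4 [P = I]` (the uniform Pauli
twirl kills every non-identity Pauli). [cite: KempeEtAl2010, Observation 4] -/
theorem sum_sign (P : Pauli) : ∑ Q, sign Q P = if P = I then 4 else 0 := by
  rw [sum_univ]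
  cases P <;> simp [sign]
  norm_num

/-- **One-qubit Pauli expansion**: `M = ½ Σ_Q Tr(σ_Q M) σ_Q` for every `2 × 2` complex matrix.
[cite: KempeEtAl2010, §2 (δ = 2^{-n} Σ_S δ̂(S) S)] -/
theorem eq_half_sum_trace_smul (M : Matrix Bool Bool ℂ) :
    M = (1 / 2 : ℂ) • ∑ Q, (mat Q * M).trace • mat Q := by
  ext a b
  simp only [sum_univ, Matrix.smul_apply, Matrix.add_apply, smul_eq_mul, Matrix.trace,
    Fintype.sum_bool, Matrix.diag_apply, mul_apply_bool]
  cases a <;> cases b <;> simp <;> ring_nf <;> simp [Complex.I_sq] <;> ring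

end Pauli

/-! ### Registers `ι → Bool`: tensor products, Pauli strings, coefficients -/

variable {ι : Type*} [Fintype ι] [DecidableEq ι]

/-- The tensor product `⊗ᵢ Aᵢ` of one-qubit matrices indexed by the wires, as a matrix on the
register `ι → Bool`: entry `(x, y) ↦ ∏ᵢ Aᵢ (xᵢ) (yᵢ)`. [folklore] -/
def tensorAll (A : ι → Matrix Bool Bool ℂ) : Matrix (ι → Bool) (ι → Bool) ℂ :=
  Matrix.of fun x y => ∏ i, A i (x i) (y i)

omit [DecidableEq ι] in
/-- Entries of `tensorAll`. [folklore] -/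
@[simp] theorem tensorAll_apply (A : ι → Matrix Bool Bool ℂ) (x y : ι → Bool) :
    tensorAll A x y = ∏ i, A i (x i) (y i) := rfl

/-- The Pauli string `⊗ᵢ σ_{Sᵢ}` of a word `S : ι → Pauli`. [cite: KempeEtAl2010, §2 (𝒫ⁿ)] -/
def pauliString (S : ι → Pauli) : Matrix (ι → Bool) (ι → Bool) ℂ :=
  tensorAll fun i => (S i).mat

omit [DecidableEq ι] in
/-- Unfolding of `pauliString`. [folklore] -/
theorem pauliString_eq (S : ι → Pauli) : pauliString S = tensorAll fun i => (S i).mat := rfl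

/-- The **Pauli coefficient** `M̂(S) = Tr(S · M)` of a matrix on the register.
[cite: KempeEtAl2010, §2 (δ̂(S) := Tr(δ S))] -/
def pauliCoeff (M : Matrix (ι → Bool) (ι → Bool) ℂ) (S : ι → Pauli) : ℂ :=
  (pauliString S * M).trace

/-- Unfolding of `pauliCoeff`. [folklore] -/
theorem pauliCoeff_eq (M : Matrix (ι → Bool) (ι → Bool) ℂ) (S : ι → Pauli) :
    pauliCoeff M S = (pauliString S * M).trace := rfl

/-! ### Strings supported in a wire set, Pauli weight, partial trace -/

/-- The Pauli strings supported inside the wire set `W` (identity outside `W`): the set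
`𝒫^W ⊗ I^{ι ∖ W}` of Observation 3. [cite: KempeEtAl2010, §2 (supp(S)) and Observation 3] -/
def stringsOn (W : Finset ι) : Finset (ι → Pauli) :=
  Fintype.piFinset fun i => if i ∈ W then Finset.univ else {Pauli.I}

/-- Membership in `stringsOn W`: identity outside `W`. [folklore] -/
theorem mem_stringsOn {W : Finset ι} {S : ι → Pauli} :
    S ∈ stringsOn W ↔ ∀ i, i ∉ W → S i = Pauli.I := by
  rw [stringsOn, Fintype.mem_piFinset]
  refine forall_congr' fun i => ?_
  by_cases h : i ∈ W <;> simp [h]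

/-- The **Pauli weight** of `M` on `W`: `Σ_{supp S ⊆ W} |Tr(S M)|²`, i.e. the quantity
`Σ_{S ∈ 𝒫^W} δ̂_W(S)²` of Lemma 7 written through Observation 3 (`δ̂(S I^{rest}) = δ̂_W(S)`).
[cite: KempeEtAl2010, Lemma 7 and Observation 3] -/
def pauliWeight (M : Matrix (ι → Bool) (ι → Bool) ℂ) (W : Finset ι) : ℝ :=
  ∑ S ∈ stringsOn W, ‖pauliCoeff M S‖ ^ 2

/-- Unfolding of `pauliWeight`. [folklore] -/
theorem pauliWeight_eq (M : Matrix (ι → Bool) (ι → Bool) ℂ) (W : Finset ι) :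
    pauliWeight M W = ∑ S ∈ stringsOn W, ‖pauliCoeff M S‖ ^ 2 := rfl

/-- The **partial trace onto `W`**, embedded in the register: for labels `x, y` vanishing
outside `W`, `(reduceTo W M) x y = Σ_z M (x ⊕ z) (y ⊕ z)`, the sum over the labels `z`
vanishing on `W` (`x ⊕ z` agrees with `x` on `W` and with `z` outside); all other entries are
`0`. This is the reduced operator `M_W = Tr_{ι ∖ W} M` of §3 ("tracing out from the resulting
state all qubits that are not in `V`"), written on the block `{x : x|_{ι∖W} = 0} ≃ (W → Bool)`
so that no new index type is needed. [cite: KempeEtAl2010, §3 (ρ_V) and Observation 3] -/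
def reduceTo (W : Finset ι) (M : Matrix (ι → Bool) (ι → Bool) ℂ) :
    Matrix (ι → Bool) (ι → Bool) ℂ :=
  Matrix.of fun x y => ∑ z : ι → Bool,
    if (∀ i, i ∉ W → x i = false) ∧ (∀ i, i ∉ W → y i = false) ∧ (∀ i, i ∈ W → z i = false) then
      M (fun i => if i ∈ W then x i else z i) (fun i => if i ∈ W then y i else z i)
    else 0

omit [Fintype ι] in
/-- Merging a label on `W` with a label outside `W`. [folklore] -/
theorem ite_mem_apply_eq_self {W : Finset ι} {x z : ι → Bool} (hz : ∀ i, i ∉ W → x i = z i) :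
    (fun i => if i ∈ W then x i else z i) = x := by
  funext i
  by_cases h : i ∈ W
  · rw [if_pos h]
  · rw [if_neg h, hz i h]

/-- Entries of `reduceTo`. [folklore] -/
theorem reduceTo_apply (W : Finset ι) (M : Matrix (ι → Bool) (ι → Bool) ℂ) (x y : ι → Bool) :
    reduceTo W M x y = ∑ z : ι → Bool,
      if (∀ i, i ∉ W → x i = false) ∧ (∀ i, i ∉ W → y i = false) ∧ (∀ i, i ∈ W → z i = false) then
        M (fun i => if i ∈ W then x i else z i) (fun i => if i ∈ W then y i else z i)
      else 0 := rfl

/-- Reducing to the full wire set does nothing. [folklore] -/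
theorem reduceTo_univ (M : Matrix (ι → Bool) (ι → Bool) ℂ) : reduceTo Finset.univ M = M := by
  ext x y
  rw [reduceTo_apply, Finset.sum_eq_single (fun _ => false)]
  · simp
  · intro z _ hz
    rw [if_neg]
    rintro ⟨-, -, h⟩
    exact hz (funext fun i => h i (Finset.mem_univ i))
  · exact fun h => absurd (Finset.mem_univ _) h

end Literature.Computability.QuantumComplexity
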